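import Summits.AtomisticToContinuum.Crystallization.Theorems.PricedLinkCensusTruncatedCensusGapStrainedMarginCertDefs

/-!
# Strained-margin certificate — analysis of the class term (soundness, part 1)

Route `PricedLinkCensus`, crux `TruncatedCensusGap` (stmt-AtomisticToContinuum-14230), line
`near-far-split`, stub `stub_strainedMarginCert` (N1b).  Real analysis behind the box checker of
`…StrainedMarginCertDefs`: the function `L(w) = w⁻⁶/12 − w⁻³/6 = V_LJ(√w)` (sign, monotonicity
on `[1, ∞)`, first and second derivative, convexity where `w³ ≤ 7/4`, concavity of the products
`(α + βw) L(w)` where `w³ ≥ 7/4`), the class term `g(w) = V_χ(√w)` on both sides of the kink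
`w = 9/4`, the validated square-root brackets and cut-off estimates, and the two-point convexity
of the cut-off `χ₊ = max 0 (4 − 2√·)`.  All `[folklore]`.
-/

noncomputable section

namespace Summit.AtomisticToContinuum.Crystallization.Theorems.PricedLinkCensusTruncatedCensusGap.StrainedMargin

/-! ## Analysis of `L` and `g` (soundness, part LJ) -/

section LJ
open Real Set

/-- Cast of `Lq`. [folklore] -/
theorem cast_Lq (w : ℚ) : ((Lq w : ℚ) : ℝ) = LR w := by
  simp only [Lq, LR]; push_cast; ring

/-- Cast of `Lpq`. [folklore] -/
theorem cast_Lpq (w : ℚ) : ((Lpq w : ℚ) : ℝ) = LRd w := by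
  simp only [Lpq, LRd]; push_cast; ring

/-- `L` in terms of `z = w⁻³`: `L = z²/12 − z/6`. [folklore] -/
theorem LR_eq (w : ℝ) : LR w = ((w ^ 3)⁻¹) ^ 2 / 12 - (w ^ 3)⁻¹ / 6 := by
  simp only [LR]; rw [← inv_pow]; ring

/-- `L ≥ −1/12` everywhere. [folklore] -/
theorem neg_le_LR (w : ℝ) : -1 / 12 ≤ LR w := by
  rw [LR_eq]; nlinarith [sq_nonneg ((w ^ 3)⁻¹ - 1)]

/-- `L(w) ≤ 0` for `w ≥ 1`. [folklore] -/
theorem LR_nonpos {w : ℝ} (hw : 1 ≤ w) : LR w ≤ 0 := by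
  rw [LR_eq]
  have h3 : 1 ≤ w ^ 3 := one_le_pow₀ hw
  have hz0 : 0 < (w ^ 3)⁻¹ := by positivity
  have hz1 : (w ^ 3)⁻¹ ≤ 1 := inv_le_one_of_one_le₀ h3
  nlinarith

/-- `L` is nondecreasing on `[1, ∞)`. [folklore] -/
theorem LR_mono {x y : ℝ} (hx : 1 ≤ x) (hxy : x ≤ y) : LR x ≤ LR y := by
  rw [LR_eq, LR_eq]
  have hx3 : 1 ≤ x ^ 3 := one_le_pow₀ hx
  have hy1 : 1 ≤ y := hx.trans hxy
  have hxy3 : x ^ 3 ≤ y ^ 3 := by gcongr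
  have hp1 : (x ^ 3)⁻¹ ≤ 1 := inv_le_one_of_one_le₀ hx3
  have hq0 : 0 < (y ^ 3)⁻¹ := by positivity
  have hqp : (y ^ 3)⁻¹ ≤ (x ^ 3)⁻¹ := by
    apply inv_anti₀ (by positivity) hxy3
  -- `L y − L x = (q − p)(q + p − 2)/12 ≥ 0` with `q ≤ p ≤ 1`
  nlinarith [mul_nonneg (sub_nonneg.2 hqp) (by linarith : (0:ℝ) ≤ 2 - (x ^ 3)⁻¹ - (y ^ 3)⁻¹)]

/-- Derivative of `L` (`w ≠ 0`). [folklore] -/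
theorem hasDerivAt_LR {w : ℝ} (hw : w ≠ 0) : HasDerivAt LR (LRd w) w := by
  have h6 : HasDerivAt (fun x : ℝ => (x ^ 6)⁻¹) (-(6 * w ^ 5) / (w ^ 6) ^ 2) w :=
    (hasDerivAt_pow 6 w).inv (pow_ne_zero _ hw)
  have h3 : HasDerivAt (fun x : ℝ => (x ^ 3)⁻¹) (-(3 * w ^ 2) / (w ^ 3) ^ 2) w :=
    (hasDerivAt_pow 3 w).inv (pow_ne_zero _ hw)
  have h := (h6.div_const 12).sub (h3.div_const 6)
  have hval : -(6 * w ^ 5) / (w ^ 6) ^ 2 / 12 - -(3 * w ^ 2) / (w ^ 3) ^ 2 / 6 = LRd w := by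
    simp only [LRd]; field_simp; ring
  rw [hval] at h
  exact h.congr_of_eventuallyEq (Filter.Eventually.of_forall fun x => by simp [LR])

/-- Derivative of `L'` (`w ≠ 0`). [folklore] -/
theorem hasDerivAt_LRd {w : ℝ} (hw : w ≠ 0) : HasDerivAt LRd (LRdd w) w := by
  have h4 : HasDerivAt (fun x : ℝ => (x ^ 4)⁻¹) (-(4 * w ^ 3) / (w ^ 4) ^ 2) w :=
    (hasDerivAt_pow 4 w).inv (pow_ne_zero _ hw)
  have h7 : HasDerivAt (fun x : ℝ => (x ^ 7)⁻¹) (-(7 * w ^ 6) / (w ^ 7) ^ 2) w :=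
    (hasDerivAt_pow 7 w).inv (pow_ne_zero _ hw)
  have h := (h4.div_const 2).sub (h7.div_const 2)
  have hval : -(4 * w ^ 3) / (w ^ 4) ^ 2 / 2 - -(7 * w ^ 6) / (w ^ 7) ^ 2 / 2 = LRdd w := by
    simp only [LRdd]; field_simp; ring
  rw [hval] at h
  exact h.congr_of_eventuallyEq (Filter.Eventually.of_forall fun x => by simp [LRd])

/-- `L' ≥ 0` on `[1, ∞)`. [folklore] -/
theorem LRd_nonneg {w : ℝ} (hw : 1 ≤ w) : 0 ≤ LRd w := by
  simp only [LRd]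
  have h4 : 0 < w ^ 4 := by positivity
  have h47 : w ^ 4 ≤ w ^ 7 := pow_le_pow_right₀ hw (by norm_num)
  have := inv_anti₀ h4 h47
  linarith

/-- Sign of `L''`: nonnegative where `w³ ≤ 7/4`. [folklore] -/
theorem LRdd_nonneg {w : ℝ} (hw : 0 < w) (h : w ^ 3 ≤ 7 / 4) : 0 ≤ LRdd w := by
  simp only [LRdd]
  rw [show (7 : ℝ) / 2 * (w ^ 8)⁻¹ - 2 * (w ^ 5)⁻¹ = (7 / 2 - 2 * w ^ 3) / w ^ 8 by
    field_simp]
  exact div_nonneg (by linarith) (by positivity)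

/-- Sign of `L''`: nonpositive where `w³ ≥ 7/4`. [folklore] -/
theorem LRdd_nonpos {w : ℝ} (hw : 0 < w) (h : 7 / 4 ≤ w ^ 3) : LRdd w ≤ 0 := by
  simp only [LRdd]
  rw [show (7 : ℝ) / 2 * (w ^ 8)⁻¹ - 2 * (w ^ 5)⁻¹ = (7 / 2 - 2 * w ^ 3) / w ^ 8 by
    field_simp]
  exact div_nonpos_of_nonpos_of_nonneg (by linarith) (by positivity)

/-- `L` is continuous on any interval of positive reals. [folklore] -/
theorem continuousOn_LR {w₁ w₂ : ℝ} (h0 : 0 < w₁) : ContinuousOn LR (Icc w₁ w₂) := fun x hx =>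
  (hasDerivAt_LR (by linarith [hx.1] : x ≠ 0)).continuousAt.continuousWithinAt

/-- `L` is convex on `[w₁, w₂]` when `0 < w₁` and `w₂³ ≤ 7/4`. [folklore] -/
theorem convexOn_LR {w₁ w₂ : ℝ} (h0 : 0 < w₁) (h2 : w₂ ^ 3 ≤ 7 / 4) :
    ConvexOn ℝ (Icc w₁ w₂) LR := by
  refine convexOn_of_hasDerivWithinAt2_nonneg (convex_Icc _ _) (continuousOn_LR h0)
    (f' := LRd) (f'' := LRdd) ?_ ?_ ?_
  · intro x hx
    rw [interior_Icc] at hx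
    exact (hasDerivAt_LR (by linarith [hx.1] : x ≠ 0)).hasDerivWithinAt
  · intro x hx
    rw [interior_Icc] at hx
    exact (hasDerivAt_LRd (by linarith [hx.1] : x ≠ 0)).hasDerivWithinAt
  · intro x hx
    rw [interior_Icc] at hx
    have hx2 : x ^ 3 ≤ w₂ ^ 3 := pow_le_pow_left₀ (by linarith [hx.1]) (by linarith [hx.2]) 3
    exact LRdd_nonneg (by linarith [hx.1]) (hx2.trans h2)

/-- The product `(α + β w) · L(w)` is concave on `[w₁, w₂]` when `w₁ ≥ 1`, `w₁³ ≥ 7/4`, `β ≤ 0`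
and `α + β w₂ ≥ 0`. [folklore] -/
theorem concaveOn_lin_mul_LR {α β w₁ w₂ : ℝ} (h1 : 1 ≤ w₁) (h74 : 7 / 4 ≤ w₁ ^ 3) (hβ : β ≤ 0)
    (hpos : 0 ≤ α + β * w₂) :
    ConcaveOn ℝ (Icc w₁ w₂) (fun w => (α + β * w) * LR w) := by
  have hcont : ContinuousOn (fun w => (α + β * w) * LR w) (Icc w₁ w₂) :=
    (by fun_prop : Continuous fun w : ℝ => α + β * w).continuousOn.mul (continuousOn_LR (by linarith))
  refine concaveOn_of_hasDerivWithinAt2_nonpos (convex_Icc _ _) hcont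
    (f' := fun w => β * LR w + (α + β * w) * LRd w)
    (f'' := fun w => 2 * β * LRd w + (α + β * w) * LRdd w) ?_ ?_ ?_
  · intro x hx
    rw [interior_Icc] at hx
    have hx0 : x ≠ 0 := by linarith [hx.1]
    have hlin : HasDerivAt (fun w : ℝ => α + β * w) β x := by
      simpa using ((hasDerivAt_id x).const_mul β).const_add α
    have := hlin.mul (hasDerivAt_LR hx0)
    exact (this.congr_of_eventuallyEq (Filter.Eventually.of_forall fun y => rfl)).hasDerivWithinAt
  · intro x hx
    rw [interior_Icc] at hx
    have hx0 : x ≠ 0 := by linarith [hx.1]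
    have hlin : HasDerivAt (fun w : ℝ => α + β * w) β x := by
      simpa using ((hasDerivAt_id x).const_mul β).const_add α
    have h1' := (hasDerivAt_LR hx0).const_mul β
    have h2' := hlin.mul (hasDerivAt_LRd hx0)
    have h3' := h1'.add h2'
    have h4' : HasDerivAt (fun w => β * LR w + (α + β * w) * LRd w)
        (β * LRd x + (β * LRd x + (α + β * x) * LRdd x)) x :=
      h3'.congr_of_eventuallyEq (Filter.Eventually.of_forall fun y => rfl)
    refine (h4'.congr_deriv ?_).hasDerivWithinAt
    ring
  · intro x hx
    rw [interior_Icc] at hx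
    have hx1 : 1 ≤ x := by linarith [hx.1]
    have hx3 : 7 / 4 ≤ x ^ 3 := h74.trans (pow_le_pow_left₀ (by linarith) (by linarith [hx.1]) 3)
    have hA : 0 ≤ α + β * x := by nlinarith [hx.2]
    have t1 : 2 * β * LRd x ≤ 0 := by
      have := LRd_nonneg hx1; nlinarith
    have t2 : (α + β * x) * LRdd x ≤ 0 :=
      mul_nonpos_of_nonneg_of_nonpos hA (LRdd_nonpos (by linarith) hx3)
    linarith

end LJ


/-- Casting an inequality of rationals to the reals. [folklore] -/
theorem castLE {p q : ℚ} (h : p ≤ q) : (p : ℝ) ≤ (q : ℝ) := Rat.cast_le.2 h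

/-! ## The class term `g` (soundness, part G) -/

section G
open Real Set Literature.MathematicalPhysics.StatisticalMechanics

/-- `V_LJ(√w) = L(w)` for `w > 0`. [folklore] -/
theorem lennardJones_sqrt {w : ℝ} (hw : 0 < w) : lennardJones (√w) = LR w := by
  simp only [lennardJones, LR]
  have h2 : (√w) ^ 2 = w := Real.sq_sqrt hw.le
  have h12 : (√w)⁻¹ ^ 12 = (w ^ 6)⁻¹ := by
    rw [inv_pow, show (√w) ^ 12 = ((√w) ^ 2) ^ 6 by ring, h2]
  have h6 : (√w)⁻¹ ^ 6 = (w ^ 3)⁻¹ := by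
    rw [inv_pow, show (√w) ^ 6 = ((√w) ^ 2) ^ 3 by ring, h2]
  rw [h12, h6]; ring

/-- `√(9/4) = 3/2`. [folklore] -/
theorem sqrt_nine_quarters : √(9 / 4 : ℝ) = 3 / 2 := by
  rw [show (9 / 4 : ℝ) = (3 / 2) ^ 2 by norm_num, Real.sqrt_sq (by norm_num)]

/-- Below the kink `g = L`. [folklore] -/
theorem gR_eq_LR {w : ℝ} (hw : 0 < w) (h : w ≤ 9 / 4) : gR w = LR w := by
  have hs : √w ≤ 3 / 2 := by rw [← sqrt_nine_quarters]; exact Real.sqrt_le_sqrt h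
  have h1 : (1 : ℝ) ≤ max 0 (4 - 2 * √w) := le_max_of_le_right (by linarith)
  simp only [gR, min_eq_left h1, one_mul, lennardJones_sqrt hw]

/-- Above the kink `g = χ₊ · L`, `χ₊ = max 0 (4 − 2√w)`. [folklore] -/
theorem gR_eq_max_mul {w : ℝ} (h : 9 / 4 ≤ w) : gR w = max 0 (4 - 2 * √w) * LR w := by
  have hw : 0 < w := by linarith
  have hs : 3 / 2 ≤ √w := by rw [← sqrt_nine_quarters]; exact Real.sqrt_le_sqrt h
  have h1 : max 0 (4 - 2 * √w) ≤ 1 := max_le (by norm_num) (by linarith)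
  simp only [gR, min_eq_right h1, lennardJones_sqrt hw]

/-- `g ≥ min (L, 0)` (the cut-off lies in `[0, 1]`). [folklore] -/
theorem min_LR_zero_le_gR {w : ℝ} (hw : 0 < w) : min (LR w) 0 ≤ gR w := by
  simp only [gR, lennardJones_sqrt hw]
  have h0 : 0 ≤ min 1 (max 0 (4 - 2 * √w)) := le_min zero_le_one (le_max_left _ _)
  have h1 : min 1 (max 0 (4 - 2 * √w)) ≤ 1 := min_le_left _ _
  rcases le_total 0 (LR w) with hL | hL
  · exact (min_le_right _ _).trans (mul_nonneg h0 hL)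
  · calc min (LR w) 0 ≤ LR w := min_le_left _ _
      _ = 1 * LR w := (one_mul _).symm
      _ ≤ min 1 (max 0 (4 - 2 * √w)) * LR w := mul_le_mul_of_nonpos_right h1 hL

/-- `g ≥ −1/12`. [folklore] -/
theorem neg_le_gR {w : ℝ} (hw : 0 < w) : -1 / 12 ≤ gR w :=
  le_trans (le_min (neg_le_LR w) (by norm_num)) (min_LR_zero_le_gR hw)

/-! ### Validated square-root brackets and the cut-off estimates -/

/-- `sqrtLo x ≥ 0`. [folklore] -/
theorem sqrtLo_nonneg (x : ℚ) : 0 ≤ sqrtLo x := by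
  unfold sqrtLo; split_ifs <;> positivity

/-- `(sqrtLo x)² ≤ x` for `x ≥ 0`. [folklore] -/
theorem sqrtLo_mul_self_le {x : ℚ} (hx : 0 ≤ x) : sqrtLo x * sqrtLo x ≤ x := by
  unfold sqrtLo; split_ifs with h
  · exact h
  · simpa using hx

/-- `sqrtLo x ≤ √x`. [folklore] -/
theorem cast_sqrtLo_le_sqrt {x : ℚ} (hx : 0 ≤ x) : ((sqrtLo x : ℚ) : ℝ) ≤ √(x : ℝ) := by
  have h0 : (0 : ℝ) ≤ ((sqrtLo x : ℚ) : ℝ) := by exact_mod_cast sqrtLo_nonneg x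
  have h1 : ((sqrtLo x : ℚ) : ℝ) ^ 2 ≤ (x : ℝ) := by
    rw [sq]; exact_mod_cast sqrtLo_mul_self_le hx
  calc ((sqrtLo x : ℚ) : ℝ) = √(((sqrtLo x : ℚ) : ℝ) ^ 2) := (Real.sqrt_sq h0).symm
    _ ≤ √(x : ℝ) := Real.sqrt_le_sqrt h1

/-- `sqrtHi x ≥ 0` for `x ≥ 0`. [folklore] -/
theorem sqrtHi_nonneg {x : ℚ} (hx : 0 ≤ x) : 0 ≤ sqrtHi x := by
  unfold sqrtHi; split_ifs
  · positivity
  · linarith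

/-- `x ≤ (sqrtHi x)²` for `x ≥ 0`. [folklore] -/
theorem le_sqrtHi_mul_self {x : ℚ} (hx : 0 ≤ x) : x ≤ sqrtHi x * sqrtHi x := by
  unfold sqrtHi; split_ifs with h
  · exact h
  · nlinarith

/-- `√x ≤ sqrtHi x`. [folklore] -/
theorem sqrt_le_cast_sqrtHi {x : ℚ} (hx : 0 ≤ x) : √(x : ℝ) ≤ ((sqrtHi x : ℚ) : ℝ) := by
  have h1 : (x : ℝ) ≤ ((sqrtHi x : ℚ) : ℝ) ^ 2 := by rw [sq]; exact_mod_cast le_sqrtHi_mul_self hx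
  calc √(x : ℝ) ≤ √(((sqrtHi x : ℚ) : ℝ) ^ 2) := Real.sqrt_le_sqrt h1
    _ = ((sqrtHi x : ℚ) : ℝ) := Real.sqrt_sq (by exact_mod_cast sqrtHi_nonneg hx)

/-- `chiHi ≥ 0`. [folklore] -/
theorem chiHi_nonneg (w : ℚ) : 0 ≤ chiHi w := by
  unfold chiHi; split_ifs
  · norm_num
  · exact le_max_left _ _

/-- `chiLo ≥ 0`. [folklore] -/
theorem chiLo_nonneg (w : ℚ) : 0 ≤ chiLo w := by
  unfold chiLo; split_ifs
  · norm_num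
  · exact le_max_left _ _

/-- Above the kink, `χ₊(w) ≤ chiHi w`. [folklore] -/
theorem max_le_chiHi {w : ℚ} (hw : 9 / 4 ≤ w) :
    max 0 (4 - 2 * √(w : ℝ)) ≤ ((chiHi w : ℚ) : ℝ) := by
  have hw' : (9 / 4 : ℝ) ≤ w := by have := castLE hw; push_cast at this; exact this
  have hs : 3 / 2 ≤ √(w : ℝ) := by rw [← sqrt_nine_quarters]; exact Real.sqrt_le_sqrt hw'
  unfold chiHi; split_ifs with h
  · push_cast; exact max_le (by norm_num) (by linarith)
  · push_cast
    exact max_le_max le_rfl (by linarith [cast_sqrtLo_le_sqrt (show (0 : ℚ) ≤ w by linarith)])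

/-- Above the kink, `chiLo w ≤ χ₊(w)`. [folklore] -/
theorem chiLo_le_max {w : ℚ} (hw : 9 / 4 ≤ w) :
    ((chiLo w : ℚ) : ℝ) ≤ max 0 (4 - 2 * √(w : ℝ)) := by
  unfold chiLo; split_ifs with h
  · have : w = 9 / 4 := le_antisymm h hw
    subst this
    push_cast
    rw [sqrt_nine_quarters]; norm_num
  · push_cast
    exact max_le_max le_rfl (by linarith [sqrt_le_cast_sqrtHi (show (0 : ℚ) ≤ w by linarith)])

/-- At a rational point `q > 0`: `chiHi q · L(q) ≤ g(q)`. [folklore] -/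
theorem chiHi_mul_LR_le_gR {q : ℚ} (hq : 0 < q) : ((chiHi q : ℚ) : ℝ) * LR q ≤ gR q := by
  have hq0 : (0 : ℝ) < q := by exact_mod_cast hq
  rcases le_or_gt q (9 / 4) with h | h
  · have hR : (q : ℝ) ≤ 9 / 4 := by have := castLE h; push_cast at this; exact this
    rw [gR_eq_LR hq0 hR]
    unfold chiHi; rw [if_pos h]; push_cast; rw [one_mul]
  · have hR : (9 / 4 : ℝ) ≤ q := by have := castLE h.le; push_cast at this; exact this
    have hL : LR q ≤ 0 := LR_nonpos (by linarith)
    rw [gR_eq_max_mul hR]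
    exact mul_le_mul_of_nonpos_right (max_le_chiHi h.le) hL

/-- At a rational point `q > 0`: `g(q) ≤ gHi q`. [folklore] -/
theorem gR_le_gHi {q : ℚ} (hq : 0 < q) : gR q ≤ ((gHi q : ℚ) : ℝ) := by
  have hq0 : (0 : ℝ) < q := by exact_mod_cast hq
  unfold gHi
  push_cast; rw [cast_Lq]
  rcases le_or_gt q (9 / 4) with h | h
  · have hR : (q : ℝ) ≤ 9 / 4 := by have := castLE h; push_cast at this; exact this
    rw [gR_eq_LR hq0 hR]
    unfold chiLo; rw [if_pos h]; push_cast; rw [one_mul]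
  · have hR : (9 / 4 : ℝ) ≤ q := by have := castLE h.le; push_cast at this; exact this
    have hL : LR q ≤ 0 := LR_nonpos (by linarith)
    rw [gR_eq_max_mul hR]
    exact mul_le_mul_of_nonpos_right (chiLo_le_max h.le) hL

/-- **Convexity of the cut-off**: the two-point chord inequality for `χ₊ = max 0 (4 − 2√·)`
(from the concavity of `√`, proved by squaring). [folklore] -/
theorem max_chord {x y a b : ℝ} (hx : 0 ≤ x) (hy : 0 ≤ y) (ha : 0 ≤ a) (hb : 0 ≤ b)
    (hab : a + b = 1) :
    max 0 (4 - 2 * √(a * x + b * y)) ≤ a * max 0 (4 - 2 * √x) + b * max 0 (4 - 2 * √y) := by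
  have hsx := Real.sq_sqrt hx
  have hsy := Real.sq_sqrt hy
  have hs : a * √x + b * √y ≤ √(a * x + b * y) := by
    have hp0 : 0 ≤ a * √x + b * √y := by positivity
    have key : a * x + b * y - (a * √x + b * √y) ^ 2 = a * b * (√x - √y) ^ 2 := by
      have hb' : b = 1 - a := by linarith
      rw [hb']; nth_rewrite 1 [← hsx, ← hsy]; ring
    have hle : (a * √x + b * √y) ^ 2 ≤ a * x + b * y := by
      nlinarith [mul_nonneg (mul_nonneg ha hb) (sq_nonneg (√x - √y))]
    calc a * √x + b * √y = √((a * √x + b * √y) ^ 2) := (Real.sqrt_sq hp0).symm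
      _ ≤ √(a * x + b * y) := Real.sqrt_le_sqrt hle
  refine max_le ?_ ?_
  · exact add_nonneg (mul_nonneg ha (le_max_left _ _)) (mul_nonneg hb (le_max_left _ _))
  · calc 4 - 2 * √(a * x + b * y) ≤ a * (4 - 2 * √x) + b * (4 - 2 * √y) := by nlinarith
      _ ≤ a * max 0 (4 - 2 * √x) + b * max 0 (4 - 2 * √y) :=
        add_le_add (mul_le_mul_of_nonneg_left (le_max_right _ _) ha)
          (mul_le_mul_of_nonneg_left (le_max_right _ _) hb)

end G

/-- **Registered sub-goal `cutoff_chord`** (summary of this file's key inequality): the cut-off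
`χ₊ = max 0 (4 − 2√·)` is convex — two-point chord form. [folklore] -/
theorem cutoff_chord : ∀ (x y a b : ℝ), 0 ≤ x → 0 ≤ y → 0 ≤ a → 0 ≤ b → a + b = 1 → max 0 (4 - 2 * √(a * x + b * y)) ≤ a * max 0 (4 - 2 * √x) + b * max 0 (4 - 2 * √y) :=
  fun _ _ _ _ hx hy ha hb hab => max_chord hx hy ha hb hab

end Summit.AtomisticToContinuum.Crystallization.Theorems.PricedLinkCensusTruncatedCensusGap.StrainedMargin
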